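import Literature.MathematicalPhysics.QuantumLattice.HeisenbergModel
import HarnessLib

/-!
# Spin-matrix entries, the exchange operator in the product basis, and the spin flip

Trunk **T-QLATTICE**. First of the proof files behind the named fact
`Literature.MathematicalPhysics.QuantumLattice.no_unique_gapped_groundState_halfOddSpin`
(`InfiniteVolume.lean`; Affleck–Lieb 1986, Tasaki 2022 Cor. 3.6: a half-odd-integer-spin
Heisenberg chain has no unique gapped ground state). The Affleck–Lieb / Lieb–Schultz–Mattis
argument manipulates the exchange operator `𝐒_x · 𝐒_y` with *diagonal twist unitaries*
`exp(-i Σ_x θ_x S^z_x)` and with the *spin flip* (the `π`-rotation about the `x`-axis,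
`S^z ↦ -S^z`); everything it needs about `𝐒_x · 𝐒_y` is contained in its matrix entries in the
product basis `|σ⟩ = ⨂_x |σ_x⟩` (Tasaki 2022, eq. (3.7): `𝐒_x·𝐒_y = ½(S⁺_x S⁻_y + S⁻_x S⁺_y) + S^z_x S^z_y`,
the "`U(1)` structure" used in Lemma 3.1 there). This file records, from the concrete spin
matrices of `SpinOperators.lean` (`spinZ = diag(n/2 - k)`, `⟨k|S⁺|k+1⟩ = √((k+1)(n-k))`):

* the entries of a product of two single-site operators at distinct sites
  (`onSite_mul_onSite_apply`), of the bond operators (`spinBond_apply_of_ne`) and of the exchange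
  operator (`spinDot_apply_of_ne`:
  `⟨σ|𝐒_x·𝐒_y|τ⟩ = [σ = τ off {x,y}] (½(S⁺S⁻' + S⁻S⁺') + S^z S^z')`), and the resulting
  **selection rule** `spinDot_apply_ne_zero`: a nonzero entry has `σ = τ` off `{x, y}` and either
  `σ = τ`, or `(σ_x, σ_y) → (τ_x, τ_y)` moves one unit of `S^z` between `x` and `y`
  (conservation of `S^z_x + S^z_y`);
* the behaviour of the spin matrices under the basis reversal `k ↦ n - k` (`Fin.rev`, i.e.
  `m ↦ -m`): `S^z ↦ -S^z`, `S⁺ ↦ S⁻`, `Sˣ ↦ Sˣ`, `Sʸ ↦ -Sʸ` (`spinVec_submatrix_rev`; this is the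
  action of the `π`-rotation about the `x`-axis, Tasaki 2020 §2.1, eq. (2.1.26)), from which the
  flip invariance of `𝐒_x·𝐒_y` follows in `InfiniteVolumeTwistProofs.lean`.

No statement of any other file is changed and no definition is introduced.

## References

* H. Tasaki, *The Lieb–Schultz–Mattis theorem: a topological point of view*, in: The Physics
  and Mathematics of Elliott Lieb, vol. 2, EMS Press (2022) 405–446, arXiv:2202.06243 (held),
  §3.1, eq. (3.7) and Lemma 3.1 (the `U(1)` structure of the bond operator). [Tasaki2022]
* H. Tasaki, *Physics and Mathematics of Quantum Many-Body Systems*, Springer GTP (2020), §2.1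
  (spin matrices, eqs. (2.1.5)–(2.1.6); `π`-rotations, eq. (2.1.26)), §2.4 eq. (2.4.1).
  [Tasaki2020]
-/

noncomputable section

open Matrix Complex

namespace Literature.MathematicalPhysics.QuantumLattice

/-! ### Single-site spin matrices under the basis reversal `k ↦ n - k` -/

section SingleSite

variable (n : ℕ)

/-- `Fin.rev` on `Fin (n+1)` is `k ↦ n - k` (as natural numbers; `k ≤ n`). [folklore] -/
theorem val_rev_eq (k : Fin (n + 1)) : (k.rev : ℕ) = n - k := by
  rw [Fin.val_rev]; omega

/-- `Fin.rev` on `Fin (n+1)` is `k ↦ n - k`, read in `ℂ`. [folklore] -/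
theorem natCast_val_rev (k : Fin (n + 1)) : ((k.rev : ℕ) : ℂ) = (n : ℂ) - (k : ℕ) := by
  rw [val_rev_eq, Nat.cast_sub (Nat.lt_succ_iff.mp k.2)]

/-- `Fin.rev` on `Fin (n+1)` is `k ↦ n - k`, read in `ℝ`. [folklore] -/
theorem natCast_val_rev_real (k : Fin (n + 1)) : ((k.rev : ℕ) : ℝ) = (n : ℝ) - (k : ℕ) := by
  rw [val_rev_eq, Nat.cast_sub (Nat.lt_succ_iff.mp k.2)]

/-- Under the basis reversal `m ↦ -m` the spin-`z` matrix changes sign: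
`⟨n-k| Sᶻ |n-l⟩ = -⟨k| Sᶻ |l⟩`. Tasaki (2020) §2.1, eq. (2.1.5). [cite: Tasaki2020, §2.1 eq. (2.1.5)] -/
theorem spinZ_rev_rev (k l : Fin (n + 1)) :
    SpinOperators.spinZ n k.rev l.rev = -SpinOperators.spinZ n k l := by
  rw [spinZ_apply, spinZ_apply]
  simp only [Fin.rev_inj]
  split_ifs
  · rw [natCast_val_rev]; ring
  · rw [neg_zero]

/-- Under the basis reversal `m ↦ -m` the raising operator becomes the lowering operator:
`⟨n-k| S⁺ |n-l⟩ = ⟨k| S⁻ |l⟩`. Tasaki (2020) §2.1, eq. (2.1.6). [cite: Tasaki2020, §2.1 eq. (2.1.6)] -/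
theorem spinRaise_rev_rev (k l : Fin (n + 1)) :
    spinRaise n k.rev l.rev = spinLower n k l := by
  rw [spinRaise_apply, spinLower_eq_conjTranspose, conjTranspose_apply, spinRaise_apply]
  have hk := Nat.lt_succ_iff.mp k.2
  have hl := Nat.lt_succ_iff.mp l.2
  simp only [val_rev_eq]
  by_cases h : k.val = l.val + 1
  · rw [if_pos (by omega), if_pos h, Complex.star_def, Complex.conj_ofReal]
    congr 2
    rw [Nat.cast_sub hk]
    have : (k.val : ℝ) = l.val + 1 := by exact_mod_cast h
    rw [this]
    ring
  · rw [if_neg (by omega), if_neg h, star_zero]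

/-- Under the basis reversal `m ↦ -m` the lowering operator becomes the raising operator.
Tasaki (2020) §2.1, eq. (2.1.6). [cite: Tasaki2020, §2.1 eq. (2.1.6)] -/
theorem spinLower_rev_rev (k l : Fin (n + 1)) :
    spinLower n k.rev l.rev = spinRaise n k l := by
  rw [← spinRaise_rev_rev, Fin.rev_rev, Fin.rev_rev]

/-- Entries of `Sˣ = (S⁺ + S⁻)/2`. Tasaki (2020) §2.1, eq. (2.1.6). [cite: Tasaki2020, §2.1 eq. (2.1.6)] -/
theorem spinX_apply (k l : Fin (n + 1)) :
    spinX n k l = 1 / 2 * (spinRaise n k l + spinLower n k l) := by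
  simp only [spinX, Matrix.smul_apply, Matrix.add_apply, smul_eq_mul]

/-- Entries of `Sʸ = (S⁺ - S⁻)/(2i)`. Tasaki (2020) §2.1, eq. (2.1.6). [cite: Tasaki2020, §2.1 eq. (2.1.6)] -/
theorem spinY_apply (k l : Fin (n + 1)) :
    spinY n k l = 1 / (2 * I) * (spinRaise n k l - spinLower n k l) := by
  simp only [spinY, Matrix.smul_apply, Matrix.sub_apply, smul_eq_mul]

/-- **The spin matrices under the basis reversal** `k ↦ n - k` (`m ↦ -m`):
`Sˣ ↦ Sˣ`, `Sʸ ↦ -Sʸ`, `Sᶻ ↦ -Sᶻ`, i.e. the reindexed matrix is `(1,-1,-1)_α • S^α`. This is the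
action of the `π`-rotation about the `x`-axis. Tasaki (2020) §2.1, eq. (2.1.26).
[cite: Tasaki2020, §2.1 eq. (2.1.26)] -/
theorem spinVec_submatrix_rev (α : Fin 3) :
    (spinVec n α).submatrix Fin.rev Fin.rev = (![1, -1, -1] : Fin 3 → ℂ) α • spinVec n α := by
  ext k l
  rw [submatrix_apply, Matrix.smul_apply, smul_eq_mul]
  fin_cases α
  · show spinVec n 0 k.rev l.rev = (![1, -1, -1] : Fin 3 → ℂ) 0 * spinVec n 0 k l
    rw [spinVec_zero, spinX_apply, spinX_apply, spinRaise_rev_rev, spinLower_rev_rev]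
    simp only [cons_val_zero]
    ring
  · show spinVec n 1 k.rev l.rev = (![1, -1, -1] : Fin 3 → ℂ) 1 * spinVec n 1 k l
    rw [spinVec_one, spinY_apply, spinY_apply, spinRaise_rev_rev, spinLower_rev_rev]
    simp only [cons_val_one, cons_val_zero]
    ring
  · show spinVec n 2 k.rev l.rev = (![1, -1, -1] : Fin 3 → ℂ) 2 * spinVec n 2 k l
    rw [spinVec_two, spinZ_rev_rev]
    simp

/-- The flip signs `(1, -1, -1)` square to `1`. [folklore] -/
theorem flipSign_mul_self (α : Fin 3) :
    (![1, -1, -1] : Fin 3 → ℂ) α * (![1, -1, -1] : Fin 3 → ℂ) α = 1 := by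
  fin_cases α <;> simp

/-- A nonzero entry `⟨k| S⁺ |l⟩` has `l = k + 1`. Tasaki (2020) §2.1, eq. (2.1.6). [cite: Tasaki2020, §2.1 eq. (2.1.6)] -/
theorem spinRaise_apply_ne_zero {k l : Fin (n + 1)} (h : spinRaise n k l ≠ 0) :
    l.val = k.val + 1 := by
  rw [spinRaise_apply] at h
  by_contra hc
  exact h (if_neg hc)

/-- A nonzero entry `⟨k| S⁻ |l⟩` has `k = l + 1`. Tasaki (2020) §2.1, eq. (2.1.6). [cite: Tasaki2020, §2.1 eq. (2.1.6)] -/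
theorem spinLower_apply_ne_zero {k l : Fin (n + 1)} (h : spinLower n k l ≠ 0) :
    k.val = l.val + 1 := by
  rw [spinLower_eq_conjTranspose, conjTranspose_apply, star_ne_zero] at h
  exact spinRaise_apply_ne_zero n h

/-- A nonzero entry `⟨k| Sᶻ |l⟩` is diagonal, `k = l`. Tasaki (2020) §2.1, eq. (2.1.5). [cite: Tasaki2020, §2.1 eq. (2.1.5)] -/
theorem spinZ_apply_ne_zero {k l : Fin (n + 1)} (h : SpinOperators.spinZ n k l ≠ 0) : k = l := by
  rw [spinZ_apply] at h
  by_contra hc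
  exact h (if_neg hc)

/-- The `U(1)` structure of the two-spin coupling, entrywise:
`Sˣ_{kl} Sˣ_{k'l'} + Sʸ_{kl} Sʸ_{k'l'} = ½ (S⁺_{kl} S⁻_{k'l'} + S⁻_{kl} S⁺_{k'l'})`.
Tasaki (2022) eq. (3.7). [cite: Tasaki2022, §3.1 eq. (3.7)] -/
theorem spinX_mul_spinX_add_spinY_mul_spinY (k l k' l' : Fin (n + 1)) :
    spinX n k l * spinX n k' l' + spinY n k l * spinY n k' l' =
      1 / 2 * (spinRaise n k l * spinLower n k' l' + spinLower n k l * spinRaise n k' l') := by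
  rw [spinX_apply, spinX_apply, spinY_apply, spinY_apply]
  have h4 : (2 * I * (2 * I) : ℂ) = -4 := by linear_combination (4 : ℂ) * I_mul_I
  have hI : (1 / (2 * I) : ℂ) * (1 / (2 * I)) = -(1 / 4) := by
    rw [div_mul_div_comm, one_mul, h4]
    norm_num
  linear_combination
    ((spinRaise n k l - spinLower n k l) * (spinRaise n k' l' - spinLower n k' l')) * hI

end SingleSite

/-! ### Products of single-site operators and the exchange operator in the product basis -/

section ManySite

variable {Λ : Type*} [Fintype Λ] [DecidableEq Λ] {q : ℕ} (n : ℕ)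

/-- **Entries of a product of single-site operators at distinct sites**:
`⟨σ| a_x b_y |τ⟩ = a_{σ_x τ_x} b_{σ_y τ_y}` if `σ = τ` off `{x, y}`, and `0` otherwise (`x ≠ y`).
Tasaki (2020) §2.2, eq. (2.2.5)–(2.2.6). [cite: Tasaki2020, §2.2 eq. (2.2.6)] -/
theorem onSite_mul_onSite_apply {x y : Λ} (hxy : x ≠ y) (a b : Matrix (Fin q) (Fin q) ℂ)
    (σ τ : TensorIndex Λ q) :
    (onSite x a * onSite y b) σ τ =
      if (∀ z, z ≠ x → z ≠ y → σ z = τ z) then a (σ x) (τ x) * b (σ y) (τ y) else 0 := by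
  rw [Matrix.mul_apply]
  set ρ₀ : TensorIndex Λ q := Function.update σ x (τ x) with hρ₀
  have hρ₀x : ρ₀ x = τ x := by rw [hρ₀, Function.update_self]
  have hρ₀ne : ∀ z, z ≠ x → ρ₀ z = σ z := fun z hz => by rw [hρ₀, Function.update_of_ne hz]
  rw [Finset.sum_eq_single ρ₀]
  · have h1 : onSite x a σ ρ₀ = a (σ x) (τ x) := by
      rw [onSite_apply, if_pos fun z hz => (hρ₀ne z hz).symm, hρ₀x]
    rw [h1, onSite_apply, hρ₀ne y hxy.symm]
    by_cases hc : ∀ z, z ≠ x → z ≠ y → σ z = τ z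
    · rw [if_pos, if_pos hc]
      intro z hz
      by_cases hzx : z = x
      · rw [hzx, hρ₀x]
      · rw [hρ₀ne z hzx]; exact hc z hzx hz
    · rw [if_neg, if_neg hc, mul_zero]
      intro h
      exact hc fun z hzx hzy => by rw [← hρ₀ne z hzx]; exact h z hzy
  · intro ρ _ hρ
    by_contra h
    obtain ⟨h1, h2⟩ := mul_ne_zero_iff.1 h
    rw [onSite_apply] at h1 h2
    have h1' : ∀ z, z ≠ x → σ z = ρ z := by by_contra hc; exact h1 (if_neg hc)
    have h2' : ∀ z, z ≠ y → ρ z = τ z := by by_contra hc; exact h2 (if_neg hc)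
    apply hρ
    funext z
    by_cases hzx : z = x
    · rw [hzx, hρ₀x]; exact h2' _ hxy
    · rw [hρ₀ne z hzx]; exact (h1' z hzx).symm
  · intro h; exact absurd (Finset.mem_univ _) h

/-- Entries of the bond operator `½(S^α_x S^α_y + S^α_y S^α_x)` for `x ≠ y`:
`[σ = τ off {x,y}] · S^α_{σ_x τ_x} S^α_{σ_y τ_y}`. Tasaki (2020) §2.4, eq. (2.4.1). [cite: Tasaki2020, §2.4 eq. (2.4.1)] -/
theorem spinBond_apply_of_ne (α : Fin 3) {x y : Λ} (hxy : x ≠ y) (σ τ : TensorIndex Λ (n + 1)) :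
    spinBond n α x y σ τ =
      if (∀ z, z ≠ x → z ≠ y → σ z = τ z) then
        spinVec n α (σ x) (τ x) * spinVec n α (σ y) (τ y) else 0 := by
  simp only [spinBond, siteSpin, Matrix.smul_apply, Matrix.add_apply, smul_eq_mul,
    onSite_mul_onSite_apply hxy, onSite_mul_onSite_apply hxy.symm]
  have hc : (∀ z, z ≠ y → z ≠ x → σ z = τ z) ↔ (∀ z, z ≠ x → z ≠ y → σ z = τ z) :=
    forall_congr' fun z => imp.swap
  rw [if_congr hc rfl rfl]
  split_ifs <;> ring

/-- **The exchange operator in the product basis** (`x ≠ y`):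
`⟨σ| 𝐒_x·𝐒_y |τ⟩ = [σ = τ off {x,y}] (½(S⁺_{σ_xτ_x} S⁻_{σ_yτ_y} + S⁻_{σ_xτ_x} S⁺_{σ_yτ_y}) + Sᶻ_{σ_xτ_x} Sᶻ_{σ_yτ_y})`,
i.e. `𝐒_x·𝐒_y = ½(S⁺_x S⁻_y + S⁻_x S⁺_y) + Sᶻ_x Sᶻ_y`. Tasaki (2022) §3.1, eq. (3.7);
Tasaki (2020) §2.4, eq. (2.4.1). [cite: Tasaki2022, §3.1 eq. (3.7)] -/
theorem spinDot_apply_of_ne {x y : Λ} (hxy : x ≠ y) (σ τ : TensorIndex Λ (n + 1)) :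
    spinDot n x y σ τ =
      if (∀ z, z ≠ x → z ≠ y → σ z = τ z) then
        1 / 2 * (spinRaise n (σ x) (τ x) * spinLower n (σ y) (τ y) +
            spinLower n (σ x) (τ x) * spinRaise n (σ y) (τ y)) +
          SpinOperators.spinZ n (σ x) (τ x) * SpinOperators.spinZ n (σ y) (τ y)
      else 0 := by
  rw [spinDot, Matrix.sum_apply, Fin.sum_univ_three, spinBond_apply_of_ne n 0 hxy,
    spinBond_apply_of_ne n 1 hxy, spinBond_apply_of_ne n 2 hxy]
  simp only [spinVec_zero, spinVec_one, spinVec_two]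
  split_ifs
  · rw [← spinX_mul_spinX_add_spinY_mul_spinY]
  · rw [add_zero, add_zero]

/-- **Selection rule for the exchange operator** (conservation of `Sᶻ_x + Sᶻ_y`, one unit moved
at a time): a nonzero entry `⟨σ| 𝐒_x·𝐒_y |τ⟩` (`x ≠ y`) has `σ = τ` off `{x, y}`, and either
`σ = τ` on `{x, y}` as well, or `(τ_x, σ_y) = (σ_x + 1, τ_y + 1)`, or `(σ_x, τ_y) = (τ_x + 1, σ_y + 1)`
(indices `k = S - m`). Tasaki (2022) §3.1, eq. (3.7) (the terms `S⁺_xS⁻_y`, `S⁻_xS⁺_y`, `Sᶻ_xSᶻ_y`).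
[cite: Tasaki2022, §3.1 eq. (3.7)] -/
theorem spinDot_apply_ne_zero {x y : Λ} (hxy : x ≠ y) {σ τ : TensorIndex Λ (n + 1)}
    (h : spinDot n x y σ τ ≠ 0) :
    (∀ z, z ≠ x → z ≠ y → σ z = τ z) ∧
      ((σ x = τ x ∧ σ y = τ y) ∨
        ((τ x).val = (σ x).val + 1 ∧ (σ y).val = (τ y).val + 1) ∨
        ((σ x).val = (τ x).val + 1 ∧ (τ y).val = (σ y).val + 1)) := by
  rw [spinDot_apply_of_ne n hxy] at h
  by_cases hc : ∀ z, z ≠ x → z ≠ y → σ z = τ z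
  · refine ⟨hc, ?_⟩
    rw [if_pos hc] at h
    by_contra hn
    simp only [not_or, not_and] at hn
    obtain ⟨hn₁, hn₂, hn₃⟩ := hn
    apply h
    have t₁ : spinRaise n (σ x) (τ x) * spinLower n (σ y) (τ y) = 0 := by
      by_contra ht
      obtain ⟨ha, hb⟩ := mul_ne_zero_iff.1 ht
      exact hn₂ (spinRaise_apply_ne_zero n ha) (spinLower_apply_ne_zero n hb)
    have t₂ : spinLower n (σ x) (τ x) * spinRaise n (σ y) (τ y) = 0 := by
      by_contra ht
      obtain ⟨ha, hb⟩ := mul_ne_zero_iff.1 ht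
      exact hn₃ (spinLower_apply_ne_zero n ha) (spinRaise_apply_ne_zero n hb)
    have t₃ : SpinOperators.spinZ n (σ x) (τ x) * SpinOperators.spinZ n (σ y) (τ y) = 0 := by
      by_contra ht
      obtain ⟨ha, hb⟩ := mul_ne_zero_iff.1 ht
      exact hn₁ (spinZ_apply_ne_zero n ha) (spinZ_apply_ne_zero n hb)
    rw [t₁, t₂, t₃]
    ring
  · exact absurd (if_neg hc) h

/-- `a ↦ onSite x a` commutes with scalars. Tasaki (2020) §2.2. [folklore] -/
theorem onSite_smul (x : Λ) (c : ℂ) (a : Matrix (Fin q) (Fin q) ℂ) :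
    onSite x (c • a) = c • onSite x a := by
  ext σ τ
  simp only [onSite_apply, Matrix.smul_apply, smul_eq_mul]
  split_ifs <;> simp

end ManySite

end Literature.MathematicalPhysics.QuantumLattice
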